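import Literature.NumberTheory.GaloisCohomology.Howard2004.InertTameGeneratorRingClassProofs
import Literature.NumberTheory.GaloisCohomology.Howard2004.FiniteSingularEvaluationLinearProofs
import Literature.NumberTheory.GaloisCohomology.Howard2004.TransverseScalarStableProofs
import Literature.NumberTheory.GaloisCohomology.Howard2004.KolyvaginPrimeOfFrobeniusProofs
import Literature.NumberTheory.GaloisCohomology.Howard2004.FiniteSingularTameAdmissible
import Literature.NumberTheory.EllipticCurves.RingClassGalOverCardinality
import HarnessLib

/-!
# Howard 2004, Prop. 1.1.9 at an inert prime — the classical degree inputs discharged (`d_K < −4`):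
# `H¹(K_λ, T) = H¹_f ⊕ H¹_tr`, also `R`-linearly with `H¹_f ≃ H¹_tr ≃ T`, from `(ℓ + 1)·T = 0` (proofs file)

Topic `NumberTheory/GaloisCohomology/Howard2004` (sequel to `InertTameGeneratorRingClassProofs`,
`TransverseComplementOfCyclicProofs`, `FiniteSingularEvaluationLinearProofs`, which prove Prop. 1.1.9 modulo two classical inputs named by binders:
`hGexp` — every element of `G_ℓ = Gal(K[ℓ]/K[1])` has order dividing `q_λ − 1` — and `#G_ℓ · T = 0`).
THEOREMS ONLY: no definition, no named fact, no instance, no `sorry`.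

Here both inputs are DISCHARGED from the tree for `K` imaginary quadratic with `d_K < −4` (Gross's standing
`D ≠ 3, 4`, i.e. `𝓞_K^× = {±1}`): `#G_ℓ = ℓ + 1` (`card_ringClassGalOver_eq_succ`, Gross 1991 §3 «`G_ℓ ≃
F_λ^×/F_ℓ^×` cyclic of order `ℓ + 1`») and `q_λ = ℓ²` at the inert `λ = (ℓ)` (`isDegreeTwo_of_span_natCast_isPrime`,
`residueFieldCard_eq_sq_of_isDegreeTwo`), so `g^{q_λ − 1} = (g^{ℓ+1})^{ℓ−1} = 1`, and a module killed by `ℓ + 1`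
(Howard's Kolyvagin primes: `p^k ∣ ℓ + 1`) is killed by `q_λ − 1 = (ℓ − 1)(ℓ + 1)` and by `#G_ℓ`.

* `residueChar_eq_of_natCast_mem`, `residueFieldCard_adicCompletion_eq_sq_of_inert` (`q_λ = ℓ²`),
  `residueFieldCard_sub_one_smul_eq_zero_of_succ_smul` (`(ℓ+1)·T = 0 ⇒ (q_λ − 1)·T = 0`),
  `pow_residueFieldCard_sub_one_eq_one_of_mem_ringClassGalOver` (`hGexp`),
  `natCard_ringClassGalOver_smul_eq_zero_of_succ_smul` (`#G_ℓ·T = 0`).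
* **`isCompl_unramifiedSubgroup_transverseCondition_of_discr_lt`** — PROP. 1.1.9: `IsCompl H¹_f H¹_tr` at an
  inert `λ ∋ ℓ`, for a finite `p`-primary `T` with trivial `Γ_{K_λ}`-action and `(ℓ + 1)·T = 0`, `d_K < −4`.
* **`exists_transverse_submodule_isCompl_linearEquiv_of_discr_lt`** — the `R`-LINEAR package: an
  `R`-submodule `V_tr` (underlying subgroup the transverse condition) with `IsCompl V_f V_tr`, `V_f ≃ₗ[R] T`,
  `V_tr ≃ₗ[R] T` — the inputs `hc` / `ef` / `etr` of the Lagrangian transfer (Prop. 1.5.9).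
(The counts `#H¹_tr(K_λ, T) = #T`, `#H¹_tr · #H¹_tr = #H¹` under these hypotheses: `InertTransverseCountOfDiscrProofs`.)
Cell `pub/bsd-print-x9`, G87 (print leaf `stub_h161` of stmt-BirchSwinnertonDyer-22642); seat `bsd-line-x9-p1-w3`
g14, brick (DISCHARGE).  BSD is not proved by any of this.

References: [Howard2004HeegnerKolyvagin] Prop. 1.1.9, §1.2; [GrossLMS1991] §1, §3; [Cox2013] §7.D.
-/

set_option autoImplicit false

noncomputable section

open NumberField IsDedekindDomain IsDedekindDomain.HeightOneSpectrum Field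

namespace Literature.NumberTheory.GaloisCohomology.Howard2004

open Literature.NumberTheory.GaloisRepresentations
open Literature.NumberTheory.GaloisRepresentations.DiscreteGaloisModule
open Literature.NumberTheory.GaloisRepresentations.IsNonarchimedeanLocalField
open Literature.NumberTheory.EllipticCurves
open Literature.NumberTheory.GaloisRepresentations.galoisCohomology

variable {K : Type} [Field K] [NumberField K]

/-! ## §1 `q_λ = ℓ²` at an inert prime and its consequences for the torsion hypotheses -/

omit [NumberField K] in
/-- The residue characteristic of a place `v ∋ ℓ` (`ℓ` a rational prime) is `ℓ`: `char(𝓞_K/v) = ℓ`.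
[cite: Howard2004HeegnerKolyvagin, §1.2 (arXiv:1202.6340 p. 6 L57–58: the rational prime `ℓ` below `λ`)]
[cite: NeukirchANT1999, Ch. I §8 (residue class fields of primes above `p` have characteristic `p`)] -/
theorem residueChar_eq_of_natCast_mem {ℓ : ℕ} (hℓ : ℓ.Prime) {v : HeightOneSpectrum (𝓞 K)}
    (hv : (ℓ : 𝓞 K) ∈ v.asIdeal) : residueChar v = ℓ := by
  haveI : Nontrivial (𝓞 K ⧸ v.asIdeal) := Ideal.Quotient.nontrivial_iff.mpr v.isPrime.ne_top
  have h0 : ((ℓ : ℕ) : 𝓞 K ⧸ v.asIdeal) = 0 := by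
    rw [← map_natCast (Ideal.Quotient.mk v.asIdeal), Ideal.Quotient.eq_zero_iff_mem]
    exact hv
  exact CharP.ringChar_of_prime_eq_zero hℓ h0

/-- **`q_λ = ℓ²` at an inert prime of a quadratic field**: for `[K : ℚ] = 2`, `(ℓ)` prime in `𝓞_K` and
`λ ∋ ℓ`, the residue field of `K_λ` has `ℓ²` elements («degree two primes»).
[cite: Howard2004HeegnerKolyvagin, §1.2 (arXiv:1202.6340 p. 6 L57–58)] [cite: GrossLMS1991, §3 (PDF p. 216)] -/
theorem residueFieldCard_adicCompletion_eq_sq_of_inert (hK2 : Module.finrank ℚ K = 2) {ℓ : ℕ}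
    (hℓ : ℓ.Prime) (hℓP : (Ideal.span {(ℓ : 𝓞 K)}).IsPrime) {v : HeightOneSpectrum (𝓞 K)}
    (hv : (ℓ : 𝓞 K) ∈ v.asIdeal) : residueFieldCard (v.adicCompletion K) = ℓ ^ 2 := by
  rw [residueFieldCard_eq_sq_of_isDegreeTwo (isDegreeTwo_of_span_natCast_isPrime hK2 hℓ hℓP hv),
    residueChar_eq_of_natCast_mem hℓ hv]

/-- **`(ℓ + 1)·T = 0 ⇒ (q_λ − 1)·T = 0`** at an inert `λ ∋ ℓ` of a quadratic field (`q_λ − 1 = (ℓ − 1)(ℓ + 1)`):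
Howard's «`|k_λ^×|·T = 0`» (Def. 1.1.8) from the Kolyvagin condition `p^k ∣ ℓ + 1`.
[cite: Howard2004HeegnerKolyvagin, Def. 1.1.8 and §1.2 (arXiv:1202.6340 p. 5 L144–146, p. 6 L57–75)] -/
theorem residueFieldCard_sub_one_smul_eq_zero_of_succ_smul {M : Type} [AddCommGroup M]
    (hK2 : Module.finrank ℚ K = 2) {ℓ : ℕ} (hℓ : ℓ.Prime) (hℓP : (Ideal.span {(ℓ : 𝓞 K)}).IsPrime)
    {v : HeightOneSpectrum (𝓞 K)} (hv : (ℓ : 𝓞 K) ∈ v.asIdeal) (hℓT : ∀ x : M, (ℓ + 1) • x = 0)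
    (x : M) : (residueFieldCard (v.adicCompletion K) - 1) • x = 0 := by
  rw [residueFieldCard_adicCompletion_eq_sq_of_inert hK2 hℓ hℓP hv,
    show ℓ ^ 2 - 1 = (ℓ - 1) * (ℓ + 1) from ?_, mul_smul, hℓT, smul_zero]
  obtain ⟨k, hk⟩ : ∃ k, ℓ = k + 1 := ⟨ℓ - 1, (Nat.sub_add_cancel hℓ.one_le).symm⟩
  subst hk
  simp only [Nat.add_sub_cancel]
  ring_nf
  omega

/-- **`hGexp` discharged: every element of `G_ℓ = Gal(K[ℓ]/K[1])` has order dividing `q_λ − 1`** for `K`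
imaginary quadratic with `d_K < −4`, `(ℓ)` inert, `λ ∋ ℓ`: `#G_ℓ = ℓ + 1` (Gross §3) and `q_λ − 1 = (ℓ − 1)(ℓ + 1)`.
[cite: GrossLMS1991, §1 (PDF p. 212), §3 (PDF p. 217 l. 1–3)] [cite: Howard2004HeegnerKolyvagin, §1.2] -/
theorem pow_residueFieldCard_sub_one_eq_one_of_mem_ringClassGalOver (hK : IsImaginaryQuadratic K)
    (hd : NumberField.discr K < -4) (ι : K →+* ℂ) {ℓ : ℕ} (hℓ : ℓ.Prime)
    (hℓP : (Ideal.span {(ℓ : 𝓞 K)}).IsPrime) {v : HeightOneSpectrum (𝓞 K)} (hv : (ℓ : 𝓞 K) ∈ v.asIdeal)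
    {g : ringClassField K ι (ℓ * 1) ≃ₐ[ℚ] ringClassField K ι (ℓ * 1)} (hg : g ∈ ringClassGalOver ι (ℓ * 1) 1) :
    g ^ (residueFieldCard (v.adicCompletion K) - 1) = 1 := by
  have hcard : Nat.card (ringClassGalOver ι (ℓ * 1) 1) = ℓ + 1 :=
    RingClassField.card_ringClassGalOver_eq_succ hK ι hℓ hℓP hℓ.not_dvd_one one_ne_zero (Or.inr hd)
  have h1 : g ^ (ℓ + 1) = 1 := by
    have h : (⟨g, hg⟩ : ringClassGalOver ι (ℓ * 1) 1) ^ Nat.card (ringClassGalOver ι (ℓ * 1) 1) = 1 :=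
      pow_card_eq_one'
    rw [hcard] at h
    exact congrArg Subtype.val h
  rw [residueFieldCard_adicCompletion_eq_sq_of_inert hK.1 hℓ hℓP hv,
    show ℓ ^ 2 - 1 = (ℓ + 1) * (ℓ - 1) from ?_, pow_mul, h1, one_pow]
  obtain ⟨k, hk⟩ : ∃ k, ℓ = k + 1 := ⟨ℓ - 1, (Nat.sub_add_cancel hℓ.one_le).symm⟩
  subst hk
  simp only [Nat.add_sub_cancel]
  ring_nf
  omega

/-- **`#G_ℓ · T = 0` from `(ℓ + 1)·T = 0`** (`d_K < −4`: `#G_ℓ = ℓ + 1`, Gross §3).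
[cite: GrossLMS1991, §3 (PDF p. 217 l. 1–3)] [cite: Howard2004HeegnerKolyvagin, §1.2] -/
theorem natCard_ringClassGalOver_smul_eq_zero_of_succ_smul {M : Type} [AddCommGroup M]
    (hK : IsImaginaryQuadratic K) (hd : NumberField.discr K < -4) (ι : K →+* ℂ) {ℓ : ℕ} (hℓ : ℓ.Prime)
    (hℓP : (Ideal.span {(ℓ : 𝓞 K)}).IsPrime) (hℓT : ∀ x : M, (ℓ + 1) • x = 0) (x : M) :
    Nat.card (ringClassGalOver ι (ℓ * 1) 1) • x = 0 := by
  rw [RingClassField.card_ringClassGalOver_eq_succ hK ι hℓ hℓP hℓ.not_dvd_one one_ne_zero (Or.inr hd)]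
  exact hℓT x

/-! ## §2 Prop. 1.1.9 at an inert prime, classical inputs discharged -/

/-- **Howard Prop. 1.1.9, `H¹(K_λ, T) = H¹_f(K_λ, T) ⊕ H¹_tr(K_λ, T)`** at an inert prime: for `K` imaginary
quadratic with `d_K < −4`, `(ℓ)` an inert rational prime, `λ ∋ ℓ`, and a finite `p`-primary `T` on which
`Γ_{K_λ}` acts trivially and with `(ℓ + 1)·T = 0` (e.g. `T = E[p^k]`, `ℓ` a Kolyvagin prime: `p^k ∣ ℓ + 1`,
`Frob_λ = Frob_ℓ²` trivial on `T`), the unramified and transverse conditions are complementary subgroups of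
`H¹(K_λ, T)`.  Composition of `isCompl_unramifiedSubgroup_transverseCondition_of_isImaginaryQuadratic` with §1.
[cite: Howard2004HeegnerKolyvagin, Prop. 1.1.9 (arXiv:1202.6340 p. 6 L17–25)] [cite: GrossLMS1991, §3] -/
theorem isCompl_unramifiedSubgroup_transverseCondition_of_discr_lt {M : Type} [AddCommGroup M]
    [TopologicalSpace M] [DiscreteTopology M] [Finite M] (p : ℕ) [Fact p.Prime]
    (hK : IsImaginaryQuadratic K) (hd : NumberField.discr K < -4) (ρ : DiscreteGaloisModule K M)
    (jbar : AlgebraicClosure K →+* ℂ) {ℓ : ℕ} (hℓ : ℓ.Prime) (hℓP : (Ideal.span {(ℓ : 𝓞 K)}).IsPrime)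
    {v : HeightOneSpectrum (𝓞 K)} (hv : (ℓ : 𝓞 K) ∈ v.asIdeal)
    (htriv : ∀ (g : absoluteGaloisGroup (v.adicCompletion K)) (x : M), GaloisRep.toLocal v ρ g x = x)
    (hp : ∀ x : M, ∃ n : ℕ, p ^ n • x = 0) (hℓT : ∀ x : M, (ℓ + 1) • x = 0) :
    IsCompl (DiscreteGaloisModule.unramifiedSubgroup (GaloisRep.toLocal v ρ) 1)
      (transverseCondition p ρ ℓ jbar v) :=
  isCompl_unramifiedSubgroup_transverseCondition_of_isImaginaryQuadratic p hK ρ jbar hℓ hℓP hv htriv hp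
    (residueFieldCard_sub_one_smul_eq_zero_of_succ_smul hK.1 hℓ hℓP hv hℓT)
    (fun _ hg => pow_residueFieldCard_sub_one_eq_one_of_mem_ringClassGalOver hK hd _ hℓ hℓP hv hg)
    (natCard_ringClassGalOver_smul_eq_zero_of_succ_smul hK hd _ hℓ hℓP hℓT)

/-! ## §3 Prop. 1.1.9 `R`-linearly: the inputs `hc`, `ef`, `etr` of the Lagrangian transfer (Prop. 1.5.9) -/

/-- **Howard Prop. 1.1.9, `R`-linear package at an inert Kolyvagin prime.**  For `T` finite `p`-primary with an
`R`-linear action of `Γ_{K_λ}` (`hρv`, e.g. `hρ.restrictField _` for `T ∈ Mod_{R,K}`), `K` imaginary quadratic with `d_K < −4`, `(ℓ)` inert, `λ ∋ ℓ`,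
`Γ_{K_λ}` trivial on `T` and `(ℓ + 1)·T = 0`: with Howard's `R`-module structure on `H¹(K_λ, T)` (`moduleH1`)
there is an `R`-SUBMODULE `V_tr` whose underlying subgroup is the transverse condition, COMPLEMENTARY to the
unramified submodule `V_f = H¹_f(K_λ, T)`, and both `V_f ≃ₗ[R] T` and `V_tr ≃ₗ[R] T` — «`H¹(K_λ, T) = H¹_f ⊕ H¹_tr`
… free rank two `R`-modules» when `T ≅ R²` (H.0).  These are the hypotheses `hc`, `ef`, `etr` (after composing
with `T ≅ R_k²`) of the Lagrangian-transfer form of Prop. 1.5.9 (`Literature/Algebra/Module/LagrangianSubmodules…`).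
[cite: Howard2004HeegnerKolyvagin, Prop. 1.1.9, §1.5 (arXiv:1202.6340 p. 6 L17–25, p. 9 L105–108)] -/
theorem exists_transverse_submodule_isCompl_linearEquiv_of_discr_lt {M : Type} [AddCommGroup M]
    [TopologicalSpace M] [DiscreteTopology M] [Finite M] {R : Type} [CommRing R] [Module R M]
    (p : ℕ) [Fact p.Prime] (hK : IsImaginaryQuadratic K) (hd : NumberField.discr K < -4)
    (ρ : DiscreteGaloisModule K M) (jbar : AlgebraicClosure K →+* ℂ) {ℓ : ℕ}
    (hℓ : ℓ.Prime) (hℓP : (Ideal.span {(ℓ : 𝓞 K)}).IsPrime) {v : HeightOneSpectrum (𝓞 K)}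
    (hv : (ℓ : 𝓞 K) ∈ v.asIdeal)
    (hρv : DiscreteGaloisModule.IsScalarLinear R (GaloisRep.toLocal v ρ))
    (htriv : ∀ (g : absoluteGaloisGroup (v.adicCompletion K)) (x : M), GaloisRep.toLocal v ρ g x = x)
    (hp : ∀ x : M, ∃ n : ℕ, p ^ n • x = 0) (hℓT : ∀ x : M, (ℓ + 1) • x = 0) :
    letI := galoisCohomology.moduleH1 (GaloisRep.toLocal v ρ) hρv
    ∃ Vtr : Submodule R (galoisCohomology (GaloisRep.toLocal v ρ) 1),
      Vtr.toAddSubgroup = transverseCondition p ρ ℓ jbar v ∧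
      IsCompl (DiscreteGaloisModule.unramifiedSubmodule hρv) Vtr ∧
      Nonempty (↥(DiscreteGaloisModule.unramifiedSubmodule hρv) ≃ₗ[R] M) ∧
      Nonempty (↥Vtr ≃ₗ[R] M) := by
  letI := galoisCohomology.moduleH1 (GaloisRep.toLocal v ρ) hρv
  have hq : ∀ x : M, (residueFieldCard (v.adicCompletion K) - 1) • x = 0 :=
    residueFieldCard_sub_one_smul_eq_zero_of_succ_smul hK.1 hℓ hℓP hv hℓT
  -- the transverse condition `ker res_{Γ ∩ Γ_{K[ℓ]}}` as an `R`-submodule (restriction commutes with the scalars)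
  let Vtr : Submodule R (galoisCohomology (GaloisRep.toLocal v ρ) 1) :=
    galoisCohomology.submoduleOfStable hρv (transverseCondition p ρ ℓ jbar v)
      (fun r _ hx => resSubgroup_hom_scalarMapH1_eq_zero (ρ := GaloisRep.toLocal v ρ) hρv
        (transverseFixer p ℓ jbar v) r hx)
  have hVtr : Vtr.toAddSubgroup = transverseCondition p ρ ℓ jbar v := rfl
  have hc : IsCompl (DiscreteGaloisModule.unramifiedSubmodule hρv) Vtr := by
    refine isCompl_submodule_of_isCompl _ _ ?_
    rw [DiscreteGaloisModule.toAddSubgroup_unramifiedSubmodule, hVtr]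
    exact isCompl_unramifiedSubgroup_transverseCondition_of_discr_lt p hK hd ρ jbar hℓ hℓP hv htriv hp hℓT
  obtain ⟨φ, hφ⟩ := exists_isAbsArithFrob_holds (F := v.adicCompletion K)
  obtain ⟨ef, -⟩ := nonempty_unramifiedSubmodule_linearEquiv (GaloisRep.toLocal v ρ) htriv hρv
    (IsAbsArithFrob.isFrobPow_holds hφ)
  obtain ⟨σ₀, hσ₀⟩ := exists_isTameGenerator (F := v.adicCompletion K)
  obtain ⟨etr⟩ := nonempty_linearEquiv_of_isCompl_unramifiedSubmodule (GaloisRep.toLocal v ρ) htriv hρv hσ₀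
    hq Vtr hc
  exact ⟨Vtr, hVtr, hc, ⟨ef⟩, ⟨etr⟩⟩

end Literature.NumberTheory.GaloisCohomology.Howard2004

end
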